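import Mathlib
import Summits.Ventures.HodgeRepro2.A2GaloisDescent

/-!
# Galois descent of SUBSPACES: a `Gal(L/K)`-stable `L`-subspace of `L ⊗_K V` is defined over `K`

Blind cell `pub-hodge-repro2`, seat p7 (gen 9), A1 annex (route/T4-A1-p7.md Lemma A1.3: Deligne's
«descent theory shows that it suffices to prove the proposition with `k' = k^S`» — Deligne 1982
Lemma 4.3(b), SOURCES S8, chunk p0045 l. 29; route/LEAN-ANNEX-p7.md §4).

For a finite Galois extension `L/K`, a `K`-vector space `V`, and the semilinear action
`act σ = σ ⊗ id` of `Gal(L/K)` on `L ⊗_K V` (p6's `A2GaloisDescent`, p391872, which supplies the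
descent of VECTORS: a fixed vector is `1 ⊗ v`), an `L`-subspace `W ⊆ L ⊗_K V` that is stable under
every `act σ` is the base change of the `K`-subspace `descend W := {v ∣ 1 ⊗ v ∈ W}`:

* `baseChange_descend_eq`: `IsGalStable W → (descend W).baseChange L = W`.

Proof (the trace-dual averaging argument): with `b` a `K`-basis of `L` and `d` its dual basis for
the trace form, `Σ_k σ(b_k) d_k = [σ = 1]` (`sum_aut_basis_mul_dualBasis`, from
`Σ_τ τ(d_k) τ(b_j) = δ_{kj}` and `mul_eq_one_comm` for the two square matrices), so every
`w ∈ W` is `Σ_k d_k • u_k` with `u_k := Σ_σ σ(b_k) • act σ w ∈ W` Galois-FIXED, hence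
`u_k = 1 ⊗ v_k` with `v_k ∈ descend W`.

README §8(d): uses an L-value-free non-vanishing device: NO.
-/

namespace Summit.Ventures.HodgeRepro2.A1GaloisDescentSubspace

open TensorProduct

section TraceDual

variable (K L : Type*) [Field K] [Field L] [Algebra K L] [FiniteDimensional K L] [IsGalois K L]
  {ι : Type*} [Fintype ι] [DecidableEq ι]

/-- `Σ_τ τ(d_k) τ(b_j) = δ_{kj}` for a `K`-basis `b` of `L` and its trace-dual basis `d`
(`Tr(d_k b_j) = δ_{kj}` and `Tr = Σ_τ τ`). -/
theorem sum_aut_dualBasis_mul_aut_basis (b : Module.Basis ι K L) (k j : ι) :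
    ∑ τ : Gal(L/K), τ ((Algebra.traceForm K L).dualBasis (traceForm_nondegenerate K L) b k) *
        τ (b j) = if j = k then 1 else 0 := by
  have h := LinearMap.BilinForm.apply_dualBasis_left (traceForm_nondegenerate K L) b k j
  rw [Algebra.traceForm_apply] at h
  have h2 := trace_eq_sum_automorphisms (K := K)
    ((Algebra.traceForm K L).dualBasis (traceForm_nondegenerate K L) b k * b j)
  rw [h] at h2
  simp only [map_mul] at h2
  rw [← h2]
  split_ifs <;> simp

/-- The transposed orthogonality: `Σ_k σ(b_k) d_k = [σ = 1]` (the matrices `(σ(b_k))` and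
`(σ(d_k))` are mutually inverse). -/
theorem sum_aut_basis_mul_dualBasis [DecidableEq Gal(L/K)] (b : Module.Basis ι K L)
    (σ : Gal(L/K)) :
    ∑ k, σ (b k) * (Algebra.traceForm K L).dualBasis (traceForm_nondegenerate K L) b k =
      if σ = 1 then 1 else 0 := by
  set d := (Algebra.traceForm K L).dualBasis (traceForm_nondegenerate K L) b with hd
  have hcard : Fintype.card Gal(L/K) = Fintype.card ι := by
    rw [Fintype.card_eq_nat_card, IsGalois.card_aut_eq_finrank, Module.finrank_eq_card_basis b]
  let e : Gal(L/K) ≃ ι := Fintype.equivOfCardEq hcard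
  let M : Matrix ι ι L := fun i k => (e.symm i) (b k)
  let N : Matrix ι ι L := fun k i => (e.symm i) (d k)
  have hNM : N * M = 1 := by
    ext k j
    rw [Matrix.mul_apply, Matrix.one_apply]
    rw [← Fintype.sum_equiv e (fun τ => τ (d k) * τ (b j)) (fun i => N k i * M i j)
      (fun τ => by simp [M, N])]
    rw [sum_aut_dualBasis_mul_aut_basis K L b k j]
    simp only [eq_comm]
  have hMN : M * N = 1 := mul_eq_one_comm.mp hNM
  have h := congrFun (congrFun hMN (e σ)) (e 1)
  rw [Matrix.mul_apply, Matrix.one_apply] at h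
  simp only [M, N, Equiv.symm_apply_apply, AlgEquiv.one_apply, Equiv.apply_eq_iff_eq] at h
  exact h

end TraceDual

section Action

variable {K L : Type*} [Field K] [Field L] [Algebra K L] {V : Type*} [AddCommGroup V]
  [Module K V]

/-- The action `σ ⊗ id` of `Gal(L/K)` on `L ⊗_K V` (p6's spelling `LinearMap.rTensor`). -/
abbrev act (σ : Gal(L/K)) : L ⊗[K] V →ₗ[K] L ⊗[K] V := LinearMap.rTensor V σ.toLinearMap

/-- `act σ` is `σ`-semilinear for the `L`-module structure. -/
theorem act_smul (σ : Gal(L/K)) (c : L) (x : L ⊗[K] V) : act σ (c • x) = σ c • act σ x := by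
  induction x using TensorProduct.induction_on with
  | zero => simp
  | tmul a v =>
    rw [smul_tmul', act, A2GaloisDescent.rTensor_tmul, A2GaloisDescent.rTensor_tmul, smul_tmul',
      smul_eq_mul, smul_eq_mul, map_mul]
  | add x y hx hy => rw [smul_add, map_add, hx, hy, map_add, smul_add]

/-- `act σ ∘ act τ = act (σ τ)`. -/
theorem act_act (σ τ : Gal(L/K)) (x : L ⊗[K] V) : act σ (act τ x) = act (σ * τ) x := by
  have : (σ * τ).toLinearMap = σ.toLinearMap ∘ₗ τ.toLinearMap := by ext; rfl
  rw [act, act, act, this, LinearMap.rTensor_comp, LinearMap.comp_apply]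

/-- `act 1 = id`. -/
theorem act_one (x : L ⊗[K] V) : act (1 : Gal(L/K)) x = x := by
  have : (1 : Gal(L/K)).toLinearMap = LinearMap.id := by ext; rfl
  rw [act, this, LinearMap.rTensor_id, LinearMap.id_apply]

end Action

section Descent

variable {K L : Type*} [Field K] [Field L] [Algebra K L] [FiniteDimensional K L] [IsGalois K L]
  {V : Type*} [AddCommGroup V] [Module K V]

/-- The `K`-subspace of `V` cut out by an `L`-subspace `W ⊆ L ⊗_K V`: `{v ∣ 1 ⊗ v ∈ W}`. -/
def descend (W : Submodule L (L ⊗[K] V)) : Submodule K V :=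
  (W.restrictScalars K).comap ((TensorProduct.mk K L V) 1)

omit [FiniteDimensional K L] [IsGalois K L] in
/-- Membership in `descend W`. -/
theorem mem_descend_iff {W : Submodule L (L ⊗[K] V)} {v : V} :
    v ∈ descend W ↔ (1 : L) ⊗ₜ[K] v ∈ W := by
  simp [descend]

/-- Galois stability of an `L`-subspace of `L ⊗_K V`. -/
def IsGalStable (W : Submodule L (L ⊗[K] V)) : Prop :=
  ∀ (σ : Gal(L/K)) (x : L ⊗[K] V), x ∈ W → act σ x ∈ W

omit [FiniteDimensional K L] [IsGalois K L] in
/-- `(descend W) ⊗ L ⊆ W` (no stability needed). -/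
theorem baseChange_descend_le (W : Submodule L (L ⊗[K] V)) : (descend W).baseChange L ≤ W := by
  rw [Submodule.baseChange_eq_span, Submodule.span_le]
  rintro _ ⟨v, hv, rfl⟩
  exact mem_descend_iff.mp hv

/-- **Galois descent**: a stable `W` is contained in `(descend W) ⊗ L` (the trace-dual averaging
argument). -/
theorem le_baseChange_descend (W : Submodule L (L ⊗[K] V)) (hW : IsGalStable W) :
    W ≤ (descend W).baseChange L := by
  classical
  intro w hw
  set b := Module.finBasis K L with hb
  set d := (Algebra.traceForm K L).dualBasis (traceForm_nondegenerate K L) b with hd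
  let u : Fin (Module.finrank K L) → L ⊗[K] V := fun k => ∑ σ : Gal(L/K), σ (b k) • act σ w
  have hu_mem : ∀ k, u k ∈ W := fun k =>
    Submodule.sum_mem _ fun σ _ => Submodule.smul_mem _ _ (hW σ w hw)
  have hu_fix : ∀ k (τ : Gal(L/K)), act τ (u k) = u k := by
    intro k τ
    simp only [u, map_sum, act_smul, act_act]
    exact Fintype.sum_equiv (Equiv.mulLeft τ) _ _ (fun σ => by simp [AlgEquiv.mul_apply])
  have hu : ∀ k, ∃ v, (1 : L) ⊗ₜ[K] v = u k := fun k =>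
    A2GaloisDescent.exists_one_tmul_eq_of_forall_rTensor_eq (u k) (fun τ => hu_fix k τ)
  choose v hv using hu
  have hv_mem : ∀ k, v k ∈ descend W := fun k =>
    mem_descend_iff.mpr (by rw [hv k]; exact hu_mem k)
  have hδ : ∀ σ : Gal(L/K), ∑ k, d k * σ (b k) = if σ = 1 then 1 else 0 := by
    intro σ
    rw [hd, ← sum_aut_basis_mul_dualBasis K L b σ]
    exact Finset.sum_congr rfl fun k _ => mul_comm _ _
  have key : w = ∑ k, d k • u k := by
    simp only [u, Finset.smul_sum, smul_smul]
    rw [Finset.sum_comm]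
    simp only [← Finset.sum_smul, hδ]
    rw [Finset.sum_eq_single (1 : Gal(L/K))]
    · simp [act_one]
    · intro σ _ hσ
      simp [hσ]
    · intro h
      exact absurd (Finset.mem_univ _) h
  rw [key]
  refine Submodule.sum_mem _ fun k _ => Submodule.smul_mem _ _ ?_
  rw [← hv k]
  exact Submodule.tmul_mem_baseChange_of_mem 1 (hv_mem k)

/-- **Galois descent of subspaces**: a `Gal(L/K)`-stable `L`-subspace of `L ⊗_K V` is the base
change of the `K`-subspace `descend W`. -/
theorem baseChange_descend_eq (W : Submodule L (L ⊗[K] V)) (hW : IsGalStable W) :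
    (descend W).baseChange L = W :=
  le_antisymm (baseChange_descend_le W) (le_baseChange_descend W hW)

/-- Existence form: a stable `W` is `W₀ ⊗ L` for some `K`-subspace `W₀`. -/
theorem exists_baseChange_eq (W : Submodule L (L ⊗[K] V)) (hW : IsGalStable W) :
    ∃ W₀ : Submodule K V, W₀.baseChange L = W :=
  ⟨descend W, baseChange_descend_eq W hW⟩

end Descent

end Summit.Ventures.HodgeRepro2.A1GaloisDescentSubspace
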